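import Summits.KontsevichZagierPeriods.Zeta5Search.Certificates.RayKernelBigPrime
import Summits.KontsevichZagierPeriods.Zeta5Search.Certificates.RayC5KernelBase
import Summits.KontsevichZagierPeriods.Zeta5Search.ConstantTermFloorWindow
import Summits.KontsevichZagierPeriods.Zeta5Search.ValuationLawsWindow
import Literature.NumberTheory.Irrationality.Hata1992.PrimeWindows
import HarnessLib

/-!
# ζ(5) search — certificates: the BIG-PRIME WINDOWS of the ray RayC5 in the kernel, exponent `0.4628` hypothesis-free (TYPER g16)

HONEST FRAMING: systematic search; no irrationality claim unless certified.  Valuation bookkeeping of explicit rationals;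
an effective exponent `γ < 1` is a calibration, nothing about the arithmetic nature of `ζ(5)`.

OUR work (Summit side; typer seat, generation 16; generator `HOME/pub-zeta5-typer-g16/gen/gen_kernelbigprime.py C5`).
Sequel of `RayC5KernelBase` (baseline `kM0 = d⁹N♯N♯′/|ρ|`, rate `481.7066`).  On the ray `b = n·(51; 21, 19, 18, 16, 15, 13, 12)`,
`b′ = b + e₇`, `d(b) = 39n`, for the primes `23n < p ≤ 51n` the tree PROVES, prime by prime (generic slot theorems, slots
`j₁ j₂ j₃ = 6 5 4`):
* `W`, `U` are `p`-integral (`BigPrime.padicNorm_coeff_le_one_of_slots`: `b₀ + 1 ≤ p + b₆ + b₅`), and `v_p(W) ≥ 1` for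
  `p ≤ d + 1` (`BigPrime.one_le_padicValRat_coeffW_of_slots`);
* THEOREM V (`ClusterValuation.constantTermFloorLaw_window`): `v_p(V) ≥ −N_p`, and on the ray `N_p ≤ [p ≤ 24n] + [p ≤ 26n]`
  (`pairFloors_bC5_le`, `pairFloors_bC5'_le`: every pair block holds at most one multiple of `p`);
* `v_p(d_{51n}) = 1`, `v_p(N♯) ≥ 0` (`RayKernelBigPrime`).
`RayKernel.bigPrime_cert` turns these into `p^k ∣ wedgeNumZ, qNumZ` with `k = 9 + [p ≤ 39n] − N_p`, i.e. the windows
`(23,24]^8(24,26]^9(26,39]^10(39,51]^9` (times `n`; `Σ k·(B−A) = 264`), and `RayKernel.atlas_ints` divides them out of `kM0`: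
`kM n = kM0 n/Φ_n`, `kM·P_n, kM·Q(a·n) ∈ ℤ`, `kM n ≤ e^{(217.7066+ε)n}`, hence
**`c5_exponent_bigPrime` — HYPOTHESIS-FREE: every `0 ≤ γ ≤ 0.4628` is an effective exponent of the ray** (baseline
`c5_exponent_baseline`; Brown–Zudilin tie at `λ* = 65.218`, here `λ = 217.7066`).  No irrationality content (`γ < 1`).
-/

noncomputable section

open Finset Real Filter Topology

namespace Summit.KontsevichZagierPeriods.Zeta5Search.RayC5

open Summit.KontsevichZagierPeriods.Zeta5Search.DualSeries
open Summit.KontsevichZagierPeriods.Zeta5Search.DualSeriesDenominators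
open Summit.KontsevichZagierPeriods.Zeta5Search.DualSeriesBounds (natB natB_zero natB_succ inBox_natB)
open Summit.KontsevichZagierPeriods.Zeta5Search.WedgeDictionary
open Summit.KontsevichZagierPeriods.Zeta5Search.RayKernel
open Summit.KontsevichZagierPeriods.Zeta5Search.CasoratianValuation (InPolytope pairFloors)
open Summit.KontsevichZagierPeriods.Zeta5Search.ClusterValuation (constantTermFloorLaw_window)
open Summit.KontsevichZagierPeriods.Zeta5Search.BigPrime (one_le_padicValRat_coeffW_of_slots
  padicNorm_coeff_le_one_of_slots padicValRat_nonneg_of_padicNorm_le_one)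
open Literature.NumberTheory.Irrationality.Hata1992
open Literature.NumberTheory.Irrationality.BrownZudilin2022 (bOfA)
open Literature.NumberTheory.Transcendental (zetaValue)

/-! ### The ray and its partner: values, polytope, `d` -/

/-- The values of `b` (as integers). -/
theorem bC5_vals (n : ℕ) : bC5 n 0 = 51 * n ∧ bC5 n 1 = 21 * n ∧ bC5 n 2 = 19 * n ∧ bC5 n 3 = 18 * n ∧ bC5 n 4 = 16 * n ∧ bC5 n 5 = 15 * n ∧ bC5 n 6 = 13 * n ∧ bC5 n 7 = 12 * n := by
  refine ⟨bC5_zero n, ?_, ?_, ?_, ?_, ?_, ?_, ?_⟩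
  all_goals rw [bC5_succ n (by simp)]; simp [βC5]

/-- The values of `b′ = b + e₇` (as integers). -/
theorem bC5'_vals (n : ℕ) : bC5' n 0 = 51 * n ∧ bC5' n 1 = 21 * n ∧ bC5' n 2 = 19 * n ∧ bC5' n 3 = 18 * n ∧ bC5' n 4 = 16 * n ∧ bC5' n 5 = 15 * n ∧ bC5' n 6 = 13 * n ∧ bC5' n 7 = 12 * n + 1 := by
  refine ⟨?_, ?_, ?_, ?_, ?_, ?_, ?_, ?_⟩
  · rw [show bC5' n = natB (51 * n) (BC5E 1 n) from rfl, natB_zero]; push_cast; ring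
  all_goals rw [show bC5' n = natB (51 * n) (BC5E 1 n) from rfl, natB_succ _ _ (by simp)]; simp [BC5E, βC5]

/-- `b` lies in the polytope `0 ≤ 2b_i ≤ b₀`, `Σ b_i ≤ 3b₀`. -/
theorem inPolytope_bC5 (n : ℕ) : InPolytope (bC5 n) := by
  obtain ⟨h0, h1, h2, h3, h4, h5, h6, h7⟩ := bC5_vals n
  refine ⟨inBox_bC5 n, fun i hi => ?_, ?_⟩
  · have : i < 7 := mem_range.1 hi
    interval_cases i <;> simp only [h0, h1, h2, h3, h4, h5, h6, h7] <;> omega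
  · simp only [sum_range_succ, sum_range_zero, zero_add, h0, h1, h2, h3, h4, h5, h6, h7]; omega

/-- `b′` lies in the polytope (`n ≥ 1`). -/
theorem inPolytope_bC5' {n : ℕ} (hn : 1 ≤ n) : InPolytope (bC5' n) := by
  obtain ⟨h0, h1, h2, h3, h4, h5, h6, h7⟩ := bC5'_vals n
  refine ⟨(sharpAdmissible_bC5' hn).1, fun i hi => ?_, ?_⟩
  · have : i < 7 := mem_range.1 hi
    interval_cases i <;> simp only [h0, h1, h2, h3, h4, h5, h6, h7] <;> omega
  · simp only [sum_range_succ, sum_range_zero, zero_add, h0, h1, h2, h3, h4, h5, h6, h7]; omega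

/-- `d(b) = 39n`. -/
theorem dOf_bC5 (n : ℕ) : dOf (bC5 n) = 39 * n := by
  rw [← bOfA_aC5]; exact dOf_aC5 n

/-- `d(b′) = 39n − 1`. -/
theorem dOf_bC5' (n : ℕ) : dOf (bC5' n) = 39 * n - 1 := by
  obtain ⟨h0, h1, h2, h3, h4, h5, h6, h7⟩ := bC5'_vals n
  simp only [dOf, sum_range_succ, sum_range_zero, zero_add, h0, h1, h2, h3, h4, h5, h6, h7]
  ring

/-- `z / p ≤ m` once `z < (m+1)·p` (`p > 0`). -/
private theorem ediv_le_of_lt' {z p : ℤ} (hp : 0 < p) (m : ℤ) (h : z < (m + 1) * p) : z / p ≤ m := by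
  have := (Int.ediv_lt_iff_lt_mul hp).2 h
  omega

/-- The window exponent of THEOREM V on the ray: `[p ≤ 24n] + [p ≤ 26n]`. -/
def pfB (n p : ℕ) : ℤ := (if p ≤ 24 * n then (1 : ℤ) else 0) + (if p ≤ 26 * n then (1 : ℤ) else 0)

/-- The `W`-window indicator `[p ≤ 39n]` (`p ≤ d(b′) + 1`). -/
def dInd (n p : ℕ) : ℤ := (if p ≤ 39 * n then (1 : ℤ) else 0)

/-- `0 ≤ pfB`. -/
theorem pfB_nonneg (n p : ℕ) : 0 ≤ pfB n p := by unfold pfB; split_ifs <;> norm_num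

set_option maxHeartbeats 800000 in
/-- For `p > 23n`: `N_p(b) ≤ [p ≤ 24n] + [p ≤ 26n]` (every pair block `(b₀−b_i−b_k)` holds fewer than two multiples of `p`,
and only the blocks `24n, 26n` can hold one). -/
theorem pairFloors_bC5_le {n p : ℕ} (hp : 23 * n + 1 ≤ p) : pairFloors (bC5 n) p ≤ pfB n p := by
  obtain ⟨h0, h1, h2, h3, h4, h5, h6, h7⟩ := bC5_vals n
  have hp0 : (0 : ℤ) < p := by exact_mod_cast (show 0 < p by omega)
  simp only [pairFloors, sum_range_succ, sum_range_zero, zero_add, h0, h1, h2, h3, h4, h5, h6, h7]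
  norm_num
  unfold pfB
  have hpZ : (23 * n + 1 : ℤ) ≤ p := by exact_mod_cast hp
  have t0 : ((51 : ℤ) * n - 21 * n - 19 * n) / p ≤ 0 := ediv_le_of_lt' hp0 0 (by linarith)
  have t1 : ((51 : ℤ) * n - 21 * n - 18 * n) / p ≤ 0 := ediv_le_of_lt' hp0 0 (by linarith)
  have t2 : ((51 : ℤ) * n - 21 * n - 16 * n) / p ≤ 0 := ediv_le_of_lt' hp0 0 (by linarith)
  have t3 : ((51 : ℤ) * n - 21 * n - 15 * n) / p ≤ 0 := ediv_le_of_lt' hp0 0 (by linarith)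
  have t4 : ((51 : ℤ) * n - 21 * n - 13 * n) / p ≤ 0 := ediv_le_of_lt' hp0 0 (by linarith)
  have t5 : ((51 : ℤ) * n - 21 * n - 12 * n) / p ≤ 0 := ediv_le_of_lt' hp0 0 (by linarith)
  have t6 : ((51 : ℤ) * n - 19 * n - 18 * n) / p ≤ 0 := ediv_le_of_lt' hp0 0 (by linarith)
  have t7 : ((51 : ℤ) * n - 19 * n - 16 * n) / p ≤ 0 := ediv_le_of_lt' hp0 0 (by linarith)
  have t8 : ((51 : ℤ) * n - 19 * n - 15 * n) / p ≤ 0 := ediv_le_of_lt' hp0 0 (by linarith)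
  have t9 : ((51 : ℤ) * n - 19 * n - 13 * n) / p ≤ 0 := ediv_le_of_lt' hp0 0 (by linarith)
  have t10 : ((51 : ℤ) * n - 19 * n - 12 * n) / p ≤ 0 := ediv_le_of_lt' hp0 0 (by linarith)
  have t11 : ((51 : ℤ) * n - 18 * n - 16 * n) / p ≤ 0 := ediv_le_of_lt' hp0 0 (by linarith)
  have t12 : ((51 : ℤ) * n - 18 * n - 15 * n) / p ≤ 0 := ediv_le_of_lt' hp0 0 (by linarith)
  have t13 : ((51 : ℤ) * n - 18 * n - 13 * n) / p ≤ 0 := ediv_le_of_lt' hp0 0 (by linarith)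
  have t14 : ((51 : ℤ) * n - 18 * n - 12 * n) / p ≤ 0 := ediv_le_of_lt' hp0 0 (by linarith)
  have t15 : ((51 : ℤ) * n - 16 * n - 15 * n) / p ≤ 0 := ediv_le_of_lt' hp0 0 (by linarith)
  have t16 : ((51 : ℤ) * n - 16 * n - 13 * n) / p ≤ 0 := ediv_le_of_lt' hp0 0 (by linarith)
  have t17 : ((51 : ℤ) * n - 16 * n - 12 * n) / p ≤ 0 := ediv_le_of_lt' hp0 0 (by linarith)
  have t18 : ((51 : ℤ) * n - 15 * n - 13 * n) / p ≤ 0 := ediv_le_of_lt' hp0 0 (by linarith)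
  have t19 : ((51 : ℤ) * n - 15 * n - 12 * n) / p ≤ (if p ≤ 24 * n then (1 : ℤ) else 0) := by
    split_ifs with h
    · exact ediv_le_of_lt' hp0 1 (by linarith)
    · have : (24 * n : ℤ) < p := by exact_mod_cast not_le.1 h
      exact ediv_le_of_lt' hp0 0 (by linarith)
  have t20 : ((51 : ℤ) * n - 13 * n - 12 * n) / p ≤ (if p ≤ 26 * n then (1 : ℤ) else 0) := by
    split_ifs with h
    · exact ediv_le_of_lt' hp0 1 (by linarith)
    · have : (26 * n : ℤ) < p := by exact_mod_cast not_le.1 h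
      exact ediv_le_of_lt' hp0 0 (by linarith)
  linarith

set_option maxHeartbeats 800000 in
/-- For `p > 23n`: `N_p(b′) ≤ [p ≤ 24n] + [p ≤ 26n]`. -/
theorem pairFloors_bC5'_le {n p : ℕ} (hp : 23 * n + 1 ≤ p) : pairFloors (bC5' n) p ≤ pfB n p := by
  obtain ⟨h0, h1, h2, h3, h4, h5, h6, h7⟩ := bC5'_vals n
  have hp0 : (0 : ℤ) < p := by exact_mod_cast (show 0 < p by omega)
  simp only [pairFloors, sum_range_succ, sum_range_zero, zero_add, h0, h1, h2, h3, h4, h5, h6, h7]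
  norm_num
  unfold pfB
  have hpZ : (23 * n + 1 : ℤ) ≤ p := by exact_mod_cast hp
  have t0 : ((51 : ℤ) * n - 21 * n - 19 * n) / p ≤ 0 := ediv_le_of_lt' hp0 0 (by linarith)
  have t1 : ((51 : ℤ) * n - 21 * n - 18 * n) / p ≤ 0 := ediv_le_of_lt' hp0 0 (by linarith)
  have t2 : ((51 : ℤ) * n - 21 * n - 16 * n) / p ≤ 0 := ediv_le_of_lt' hp0 0 (by linarith)
  have t3 : ((51 : ℤ) * n - 21 * n - 15 * n) / p ≤ 0 := ediv_le_of_lt' hp0 0 (by linarith)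
  have t4 : ((51 : ℤ) * n - 21 * n - 13 * n) / p ≤ 0 := ediv_le_of_lt' hp0 0 (by linarith)
  have t5 : ((51 : ℤ) * n - 21 * n - (12 * n + 1)) / p ≤ 0 := ediv_le_of_lt' hp0 0 (by linarith)
  have t6 : ((51 : ℤ) * n - 19 * n - 18 * n) / p ≤ 0 := ediv_le_of_lt' hp0 0 (by linarith)
  have t7 : ((51 : ℤ) * n - 19 * n - 16 * n) / p ≤ 0 := ediv_le_of_lt' hp0 0 (by linarith)
  have t8 : ((51 : ℤ) * n - 19 * n - 15 * n) / p ≤ 0 := ediv_le_of_lt' hp0 0 (by linarith)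
  have t9 : ((51 : ℤ) * n - 19 * n - 13 * n) / p ≤ 0 := ediv_le_of_lt' hp0 0 (by linarith)
  have t10 : ((51 : ℤ) * n - 19 * n - (12 * n + 1)) / p ≤ 0 := ediv_le_of_lt' hp0 0 (by linarith)
  have t11 : ((51 : ℤ) * n - 18 * n - 16 * n) / p ≤ 0 := ediv_le_of_lt' hp0 0 (by linarith)
  have t12 : ((51 : ℤ) * n - 18 * n - 15 * n) / p ≤ 0 := ediv_le_of_lt' hp0 0 (by linarith)
  have t13 : ((51 : ℤ) * n - 18 * n - 13 * n) / p ≤ 0 := ediv_le_of_lt' hp0 0 (by linarith)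
  have t14 : ((51 : ℤ) * n - 18 * n - (12 * n + 1)) / p ≤ 0 := ediv_le_of_lt' hp0 0 (by linarith)
  have t15 : ((51 : ℤ) * n - 16 * n - 15 * n) / p ≤ 0 := ediv_le_of_lt' hp0 0 (by linarith)
  have t16 : ((51 : ℤ) * n - 16 * n - 13 * n) / p ≤ 0 := ediv_le_of_lt' hp0 0 (by linarith)
  have t17 : ((51 : ℤ) * n - 16 * n - (12 * n + 1)) / p ≤ 0 := ediv_le_of_lt' hp0 0 (by linarith)
  have t18 : ((51 : ℤ) * n - 15 * n - 13 * n) / p ≤ 0 := ediv_le_of_lt' hp0 0 (by linarith)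
  have t19 : ((51 : ℤ) * n - 15 * n - (12 * n + 1)) / p ≤ (if p ≤ 24 * n then (1 : ℤ) else 0) := by
    split_ifs with h
    · exact ediv_le_of_lt' hp0 1 (by linarith)
    · have : (24 * n : ℤ) < p := by exact_mod_cast not_le.1 h
      exact ediv_le_of_lt' hp0 0 (by linarith)
  have t20 : ((51 : ℤ) * n - 13 * n - (12 * n + 1)) / p ≤ (if p ≤ 26 * n then (1 : ℤ) else 0) := by
    split_ifs with h
    · exact ediv_le_of_lt' hp0 1 (by linarith)
    · have : (26 * n : ℤ) < p := by exact_mod_cast not_le.1 h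
      exact ediv_le_of_lt' hp0 0 (by linarith)
  linarith

section Prime

variable {n p : ℕ}

/-- `51n + 2 < p²` for `p > 23n`, `n ≥ 1`. -/
theorem window_sq_c5 (hlo : 23 * n + 1 ≤ p) (hn : 1 ≤ n) : (51 * n : ℤ) + 2 < (p : ℤ) ^ 2 := by
  have h1 : (23 * n + 1 : ℤ) ≤ p := by exact_mod_cast hlo
  have h2 : (1 : ℤ) ≤ n := by exact_mod_cast hn
  nlinarith

/-- Slot facts of `b` for the big-prime theorems (`b₇ ≤ b₆ ≤ b₅ ≤` the rest). -/
theorem slots_bC5 (n : ℕ) : bC5 n (5 + 1) ≤ bC5 n (4 + 1) ∧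
    (∀ j ∈ range 7, j ≠ 6 → j ≠ 5 → bC5 n (4 + 1) ≤ bC5 n (j + 1)) := by
  obtain ⟨h0, h1, h2, h3, h4, h5, h6, h7⟩ := bC5_vals n
  refine ⟨by rw [h6, h5]; omega, fun j hj hj6 hj5 => ?_⟩
  have : j < 7 := mem_range.1 hj
  interval_cases j <;> simp_all <;> omega

/-- Slot facts of `b′`. -/
theorem slots_bC5' (n : ℕ) : bC5' n (5 + 1) ≤ bC5' n (4 + 1) ∧
    (∀ j ∈ range 7, j ≠ 6 → j ≠ 5 → bC5' n (4 + 1) ≤ bC5' n (j + 1)) := by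
  obtain ⟨h0, h1, h2, h3, h4, h5, h6, h7⟩ := bC5'_vals n
  refine ⟨by rw [h6, h5]; omega, fun j hj hj6 hj5 => ?_⟩
  have : j < 7 := mem_range.1 hj
  interval_cases j <;> simp_all <;> omega

/-- **`W`, `U` are `p`-integral, `p ∣ W` for `p ≤ 39n`, `v_p(V) ≥ −N_p`** on `b`, for `23n < p ≤ 51n`, `n ≥ 1`. -/
theorem coeff_bounds_bC5 (hn : 1 ≤ n) (hp : p.Prime) (hlo : 23 * n + 1 ≤ p) (hhi : p ≤ 51 * n) :
    (coeffW (bC5 n) ≠ 0 → dInd n p ≤ padicValRat p (coeffW (bC5 n))) ∧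
    (coeffU (bC5 n) ≠ 0 → 0 ≤ padicValRat p (coeffU (bC5 n))) ∧
    (coeffV (bC5 n) ≠ 0 → -pfB n p ≤ padicValRat p (coeffV (bC5 n))) := by
  haveI := Fact.mk hp
  have hP := inPolytope_bC5 n
  obtain ⟨hle, hmin⟩ := slots_bC5 n
  obtain ⟨h0, h1, h2, h3, h4, h5, h6, h7⟩ := bC5_vals n
  have hpT : bC5 n 0 + 1 ≤ (p : ℤ) + bC5 n (5 + 1) + bC5 n (4 + 1) := by
    rw [h0, h6, h5]
    have : (23 * n + 1 : ℤ) ≤ p := by exact_mod_cast hlo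
    linarith
  have hint := padicNorm_coeff_le_one_of_slots (bC5 n) 6 5 4 hP.1 hP.2.1 hP.2.2 (by simp) (by simp) (by simp)
    (by norm_num) hle hmin hpT
  refine ⟨fun hW => ?_, fun hU => padicValRat_nonneg_of_padicNorm_le_one hU hint.2, fun hV => ?_⟩
  · unfold dInd
    split_ifs with hd
    · exact one_le_padicValRat_coeffW_of_slots (bC5 n) p 6 5 4 hP.1 hP.2.1 hP.2.2 (by simp) (by simp) (by simp)
        (by norm_num) hle hmin hp (by omega) hpT
        (by rw [dOf_bC5]; have h' : (p : ℤ) ≤ 39 * n := (by exact_mod_cast hd); linarith) hW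
    · exact padicValRat_nonneg_of_padicNorm_le_one hW hint.1
  · have hV' := constantTermFloorLaw_window (bC5 n) p hP hp (by omega) (by rw [h0]; exact window_sq_c5 hlo hn) hV
    have := pairFloors_bC5_le (n := n) hlo
    linarith

/-- The same on the partner `b′` (`p ∣ W(b′)` for `p ≤ d(b′) + 1 = 39n`). -/
theorem coeff_bounds_bC5' (hn : 1 ≤ n) (hp : p.Prime) (hlo : 23 * n + 1 ≤ p) (hhi : p ≤ 51 * n) :
    (coeffW (bC5' n) ≠ 0 → dInd n p ≤ padicValRat p (coeffW (bC5' n))) ∧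
    (coeffU (bC5' n) ≠ 0 → 0 ≤ padicValRat p (coeffU (bC5' n))) ∧
    (coeffV (bC5' n) ≠ 0 → -pfB n p ≤ padicValRat p (coeffV (bC5' n))) := by
  haveI := Fact.mk hp
  have hP := inPolytope_bC5' hn
  obtain ⟨hle, hmin⟩ := slots_bC5' n
  obtain ⟨h0, h1, h2, h3, h4, h5, h6, h7⟩ := bC5'_vals n
  have hpT : bC5' n 0 + 1 ≤ (p : ℤ) + bC5' n (5 + 1) + bC5' n (4 + 1) := by
    rw [h0, h6, h5]
    have : (23 * n + 1 : ℤ) ≤ p := by exact_mod_cast hlo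
    linarith
  have hint := padicNorm_coeff_le_one_of_slots (bC5' n) 6 5 4 hP.1 hP.2.1 hP.2.2 (by simp) (by simp) (by simp)
    (by norm_num) hle hmin hpT
  refine ⟨fun hW => ?_, fun hU => padicValRat_nonneg_of_padicNorm_le_one hU hint.2, fun hV => ?_⟩
  · unfold dInd
    split_ifs with hd
    · exact one_le_padicValRat_coeffW_of_slots (bC5' n) p 6 5 4 hP.1 hP.2.1 hP.2.2 (by simp) (by simp) (by simp)
        (by norm_num) hle hmin hp (by omega) hpT
        (by rw [dOf_bC5']; have h' : (p : ℤ) ≤ 39 * n := (by exact_mod_cast hd); linarith) hW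
    · exact padicValRat_nonneg_of_padicNorm_le_one hW hint.1
  · have hV' := constantTermFloorLaw_window (bC5' n) p hP hp (by omega) (by rw [h0]; exact window_sq_c5 hlo hn) hV
    have := pairFloors_bC5'_le (n := n) hlo
    linarith

/-- **The per-prime certificate**: for `23n < p ≤ 51n` and every `k` with `k + N_p ≤ 9 + [p ≤ 39n]`,
`p^k ∣ wedgeNumZ b b′` and `p^k ∣ qNumZ b b′` (`RayKernel.bigPrime_cert`). -/
theorem cert_bC5 (hn : 1 ≤ n) (hp : p.Prime) (hlo : 23 * n + 1 ≤ p) (hhi : p ≤ 51 * n) {k : ℕ}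
    (hk : (k : ℤ) + pfB n p ≤ 9 + dInd n p) :
    (p : ℤ) ^ k ∣ wedgeNumZ (bC5 n) (bC5' n) ∧ (p : ℤ) ^ k ∣ qNumZ (bC5 n) (bC5' n) := by
  haveI := Fact.mk hp
  obtain ⟨hW, hU, hV⟩ := coeff_bounds_bC5 hn hp hlo hhi
  obtain ⟨hW', hU', hV'⟩ := coeff_bounds_bC5' hn hp hlo hhi
  obtain ⟨h0, h1, h2, h3, h4, h5, h6, h7⟩ := bC5_vals n
  obtain ⟨h0', h1', h2', h3', h4', h5', h6', h7'⟩ := bC5'_vals n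
  have hb2 : bn (bC5 n) 2 < p := by unfold bn; rw [h2]; omega
  have hb3 : bn (bC5 n) 3 < p := by unfold bn; rw [h3]; omega
  have hb2' : bn (bC5' n) 2 < p := by unfold bn; rw [h2']; omega
  have hb3' : bn (bC5' n) 3 < p := by unfold bn; rw [h3']; omega
  have hd : padicValRat p (dOf0 (bC5 n)) = 1 := by
    apply padicValRat_dOf0_eq_one
    · rw [bn_bC5_zero]; exact hhi
    · rw [bn_bC5_zero]
      have := window_sq_c5 hlo hn
      have h' : ((51 * n : ℕ) : ℤ) < ((p ^ 2 : ℕ) : ℤ) := by push_cast; linarith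
      exact_mod_cast h'
  have hpf := pfB_nonneg n p
  exact bigPrime_cert (sharpAdmissible_bC5 hn) (sharpAdmissible_bC5' hn) (bn0_bC5' n) hd
    (padicValRat_sharpNormaliser_nonneg_of_lt hb2 hb3) (padicValRat_sharpNormaliser_nonneg_of_lt hb2' hb3')
    hW hW' hU hU' hV hV' (by linarith) (by linarith) (by linarith) (by linarith)

end Prime

/-- Left endpoints of the 4 windows (times `n`). -/
def AwK : Fin 4 → ℝ := ![23, 24, 26, 39]

/-- Right endpoints of the 4 windows (times `n`). -/
def BwK : Fin 4 → ℝ := ![24, 26, 39, 51]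

/-- Exponents removed on the 4 windows. -/
def wwK : Fin 4 → ℕ := ![8, 9, 10, 9]

/-- The window factor `Φ_n` of the big-prime atlas. -/
def corrK (n : ℕ) : ℕ := multiWindowProd Finset.univ AwK BwK wwK n

/-- **The multiplier** `kM n = kM0 n / Φ_n`. -/
def kM (n : ℕ) : ℚ := kM0 n / (corrK n : ℚ)

/-- The windows are genuine intervals: `0 ≤ A_i ≤ B_i`. -/
theorem AwK_le_BwK : ∀ i ∈ (Finset.univ : Finset (Fin 4)), 0 ≤ AwK i ∧ AwK i ≤ BwK i := by
  intro i _
  fin_cases i <;> simp [AwK, BwK] <;> norm_num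

/-- `Σ_i w_i (B_i − A_i) = 264`. -/
theorem window_rateK : ∑ i ∈ (Finset.univ : Finset (Fin 4)), (wwK i : ℝ) * (BwK i - AwK i) = 264 := by
  simp [Fin.sum_univ_four, AwK, BwK, wwK]
  norm_num

/-- A prime of window `i` lies in `(23n, 51n]` and its exponent satisfies the certificate inequality. -/
theorem windowK_prime {n : ℕ} {i : Fin 4} {p : ℕ} (hp : p ∈ windowPrimes (AwK i) (BwK i) n) :
    p.Prime ∧ 23 * n + 1 ≤ p ∧ p ≤ 51 * n ∧ ((wwK i : ℕ) : ℤ) + pfB n p ≤ 9 + dInd n p := by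
  have hA : 0 ≤ AwK i := (AwK_le_BwK i (Finset.mem_univ _)).1
  obtain ⟨hpr, h1, h2⟩ := (mem_windowPrimes_iff hA).1 hp
  fin_cases i <;> simp [AwK, BwK, wwK] at h1 h2 ⊢
  · have a : 23 * n < p := by exact_mod_cast h1
    have b : p ≤ 24 * n := by exact_mod_cast h2
    refine ⟨hpr, by omega, by omega, ?_⟩
    simp only [pfB, dInd]
    split_ifs <;> omega
  · have a : 24 * n < p := by exact_mod_cast h1
    have b : p ≤ 26 * n := by exact_mod_cast h2
    refine ⟨hpr, by omega, by omega, ?_⟩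
    simp only [pfB, dInd]
    split_ifs <;> omega
  · have a : 26 * n < p := by exact_mod_cast h1
    have b : p ≤ 39 * n := by exact_mod_cast h2
    refine ⟨hpr, by omega, by omega, ?_⟩
    simp only [pfB, dInd]
    split_ifs <;> omega
  · have a : 39 * n < p := by exact_mod_cast h1
    have b : p ≤ 51 * n := by exact_mod_cast h2
    refine ⟨hpr, by omega, by omega, ?_⟩
    simp only [pfB, dInd]
    split_ifs <;> omega

/-- The windows are pairwise disjoint. -/
theorem windowsK_disjoint (n : ℕ) : ∀ i ∈ (Finset.univ : Finset (Fin 4)), ∀ j ∈ (Finset.univ : Finset (Fin 4)), i ≠ j →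
    Disjoint (windowPrimes (AwK i) (BwK i) n) (windowPrimes (AwK j) (BwK j) n) := by
  intro i _ j _ hij
  rw [Finset.disjoint_left]
  intro p hpi hpj
  obtain ⟨-, a1, b1⟩ := (mem_windowPrimes_iff (AwK_le_BwK i (Finset.mem_univ _)).1).1 hpi
  obtain ⟨-, a2, b2⟩ := (mem_windowPrimes_iff (AwK_le_BwK j (Finset.mem_univ _)).1).1 hpj
  fin_cases i <;> fin_cases j <;> simp [AwK, BwK] at a1 b1 a2 b2 hij <;> linarith

/-- **`0 < kM n`, `kM n · P_n ∈ ℤ`, `kM n · Q(a·n) ∈ ℤ`** for `n ≥ 1` (`RayKernel.atlas_ints` with the per-prime certificates). -/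
theorem kM_ints {n : ℕ} (hn : 1 ≤ n) :
    0 < kM n ∧ (∃ z : ℤ, kM n * c5P n = z) ∧ (∃ z : ℤ, kM n * (c5Q n : ℚ) = z) := by
  classical
  have h := atlas_ints (Finset.univ : Finset (Fin 4)) AwK BwK wwK n (sharpAdmissible_bC5 hn)
    (sharpAdmissible_bC5' hn) (bn0_bC5' n) (rhoOf_aC5_ne_zero n) (fun i _ p hp => ?_) (windowsK_disjoint n)
  · obtain ⟨h0, hP, hQ⟩ := h
    refine ⟨h0, ?_, ?_⟩
    · unfold kM kM0 corrK c5P; exact hP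
    · unfold kM kM0 corrK; rw [c5Q_eq_wedge hn]; exact hQ
  · obtain ⟨hpr, hlo, hhi, hk⟩ := windowK_prime hp
    exact cert_bC5 hn hpr hlo hhi hk

/-- **Size of the multiplier**: for every `ε > 0`, eventually `kM n ≤ e^{(217.7066 + ε)·n}` (`481.7066 − 264`). -/
theorem eventually_kM_le_exp {ε : ℝ} (hε : 0 < ε) :
    ∀ᶠ n : ℕ in atTop, ((kM n : ℚ) : ℝ) ≤ Real.exp ((1088533 / 5000 + ε) * n) := by
  have hε2 : 0 < ε / 2 := by positivity
  have hΦ := eventually_exp_le_multiWindowProd (s := (Finset.univ : Finset (Fin 4))) (w := wwK) AwK_le_BwK hε2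
  filter_upwards [eventually_kM0_le_exp hε2, hΦ] with n hM0 hcorr
  rw [window_rateK] at hcorr
  have hcorr' : Real.exp ((264 - ε / 2) * n) ≤ ((corrK n : ℕ) : ℝ) := hcorr
  have hcpos : (0 : ℝ) < ((corrK n : ℕ) : ℝ) := by exact_mod_cast multiWindowProd_pos _ _ _ _ _
  have hcast : ((kM n : ℚ) : ℝ) = ((kM0 n : ℚ) : ℝ) / ((corrK n : ℕ) : ℝ) := by
    unfold kM; push_cast; rfl
  rw [hcast]
  calc ((kM0 n : ℚ) : ℝ) / ((corrK n : ℕ) : ℝ) ≤ Real.exp ((2408533 / 5000 + ε / 2) * n) / ((corrK n : ℕ) : ℝ) :=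
        div_le_div_of_nonneg_right hM0 hcpos.le
    _ ≤ Real.exp ((2408533 / 5000 + ε / 2) * n) / Real.exp ((264 - ε / 2) * n) :=
        div_le_div_of_nonneg_left (Real.exp_pos _).le (Real.exp_pos _) hcorr'
    _ = Real.exp ((1088533 / 5000 + ε) * n) := by rw [← Real.exp_sub]; ring_nf

/-- **THE EXPONENT `0.4628` OF THE RAY RayC5, HYPOTHESIS-FREE.**  For every `0 ≤ γ ≤ 0.4628`, eventually
`|ζ(5) − P_n/Q(a·n)| < 1/q_n^γ` with the integers `p_n = kM n·P_n`, `q_n = kM n·|Q(a·n)| ≥ 1`.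
Arithmetic: `0.4628·(217.7266 + 109.9825) < 109.9821 + 41.7363`.  (HD) of `c5_exponent` discharged at `λ = 217.7066`
(Brown–Zudilin tie `λ* = 65.218`); no irrationality content (`γ < 1`). -/
theorem c5_exponent_bigPrime {γ : ℝ} (hγ0 : 0 ≤ γ) (hγ : γ ≤ 1157 / 2500) :
    ∀ᶠ n : ℕ in atTop, ∃ p : ℤ, ∃ q : ℕ, 1 ≤ q ∧ (q : ℚ) = kM n * |(c5Q n : ℚ)| ∧ (p : ℚ) = kM n * c5P n ∧
      |zetaValue 5 - (c5P n : ℝ) / (c5Q n : ℝ)| < 1 / (q : ℝ) ^ γ := by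
  refine c5_exponent_rat (lam := 1088533 / 5000 + 1 / 100) kM (fun ε hε => ?_) hγ0 (by nlinarith)
  filter_upwards [eventually_kM_le_exp hε, eventually_ge_atTop 1] with n hn hn1
  obtain ⟨h0, hP, hQ⟩ := kM_ints hn1
  refine ⟨h0, hP, hQ, hn.trans ?_⟩
  apply Real.exp_le_exp.2; nlinarith [hε, (Nat.cast_nonneg n : (0:ℝ) ≤ n)]

end Summit.KontsevichZagierPeriods.Zeta5Search.RayC5
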